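import Summits.CriticalPhenomena.PercolationContinuityZ3.Theorems.Transplant.AutCocompactWolf
import Summits.CriticalPhenomena.PercolationContinuityZ3.Theorems.Transplant.AutVirtuallyNilpotentDichotomyQT
import HarnessLib

/-!
# Conjectures 1 and 4 of Benjamini–Schramm for FREE COCOMPACT VIRTUALLY NILPOTENT ACTIONS, with purely algebraic hypotheses: on every connected locally
# finite graph carrying a free action with finitely many orbits by automorphisms of a virtually nilpotent group `A`, `p_c < 1 ⟺ A` is not virtually
# cyclic, and then `θ_x(p_c) = 0` at every vertex (rung-Q node + Wolf 1968; no growth hypothesis, no named fact)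

builds on p205010 (kernel theorem, internal audit signed; external expert review pending).  Lane `prim-bschramm`, seat `prim-bschramm-gen-1` gen 6 (GEN pen), §P-C of
lead g24's GO §P (2026-08-27).  Helper file (`--supports stmt-CriticalPhenomena-4575 --as helper`); PROOFS ONLY (def-free); NOTHING is claimed about any open node and
no 'closed' wording is used — the words are the lead's.

THE POINT.  «AutCocompactWolf» (p561153) gives `AutCyl.conj4_of_free_nilpotent`: free cocompact action of a NILPOTENT group, `p_c < 1 ⟹ θ_x(p_c) = 0`, no growth
hypothesis.  This file removes the last two non-algebraic words.  (§1) A free cocompact action of a group `A` restricts to a free cocompact action of any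
finite-index subgroup `N` (the `N`-orbit representatives are `ρ • r`, `ρ` in a finite right transversal `A = N·R` — Mathlib `Subgroup.exists_isComplement_right`,
`IsComplement.finite_right` — and `r ∈ reps`), so **`conj4_of_free_virtuallyNilpotent`**: `A` VIRTUALLY nilpotent suffices.  (§2) Freeness makes every stabiliser
trivial, so p4 gen 22's quasi-transitive dichotomy `VirtNilpotentAutQT.criticalProb_lt_one_iff_not_virtuallyCyclic` applies verbatim:
**`criticalProb_lt_one_iff_of_free_virtuallyNilpotent`**: `p_c(x) < 1 ⟺ ¬ ∃ c, [A : ⟨c⟩] < ∞`.  (§3) Together: **`conj4_of_free_virtuallyNilpotent_of_not_virtuallyCyclic`**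
— for `A` virtually nilpotent and NOT virtually cyclic, `p_c(x) < 1 ∧ θ_x(p_c) = 0` at every vertex; in the virtually cyclic case `p_c = 1`
(`AutVirtCycQT.criticalProb_eq_one`, cited, not restated).  Special cases already in the tree by other routes: every Cayley graph of a f.g. virtually nilpotent
group («AutCylinderWolf» p560483: `A = Γ` acting on itself), every `ℤ^d`-periodic graph («AutCylinderZdPeriodic»); new: every nilpotent- or virtually-nilpotent-
periodic net (free cocompact actions of, e.g., the Heisenberg group or its finite extensions).  Finite generation of `A` is automatic (finitely many orbits +
finite stabilisers, `VirtNilpotentAutQT.closure_genSetQT`) and is not a hypothesis.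
[cite: BenjaminiSchramm1996, §2 Conj. 1, Conj. 4 (almost transitive graphs)] [cite: WolfGrowth1968, Thm. 3.2] [cite: LyonsPeres2016, §7.4 Cor. 7.19]
-/

noncomputable section

namespace Summit.CriticalPhenomena.PercolationContinuityZ3.Theorems.Transplant

open SimpleGraph Literature.Barriers.CriticalPhenomena Literature.Probability.LatticeModels Literature.Probability.Percolation
open scoped Classical

namespace AutCyl

variable {W : Type} {X : SimpleGraph W} {A : Type} [Group A] [MulAction A W]

/-! ## §1 Restricting a free cocompact action to a finite-index subgroup -/

/-- **A cocompact action restricts to a cocompact action of every finite-index subgroup**: if `reps` meets every `A`-orbit and `[A : N] < ∞`, some finite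
`reps'` meets every `N`-orbit (`reps' = {ρ • r : ρ ∈ R, r ∈ reps}` for a finite right transversal `A = N·R`). [folklore] [cite: LyonsPeres2016, §7.4 (quasi-transitive actions)] -/
theorem exists_reps_of_finiteIndex (N : Subgroup A) [N.FiniteIndex] (reps : Finset W)
    (hcover : ∀ w : W, ∃ a : A, ∃ r ∈ reps, a • r = w) :
    ∃ reps' : Finset W, ∀ w : W, ∃ n : N, ∃ r ∈ reps', n • r = w := by
  obtain ⟨R, hR, -⟩ := Subgroup.exists_isComplement_right N (1 : A)
  have hRfin : R.Finite := hR.finite_right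
  refine ⟨(hRfin.toFinset ×ˢ reps).image fun q : A × W => q.1 • q.2, fun w => ?_⟩
  obtain ⟨a, r, hr, rfl⟩ := hcover w
  refine ⟨⟨(hR.equiv a).fst, (hR.equiv a).fst.2⟩, ((hR.equiv a).snd : A) • r,
    Finset.mem_image.2 ⟨(((hR.equiv a).snd : A), r), Finset.mem_product.2 ⟨hRfin.mem_toFinset.2 (hR.equiv a).snd.2, hr⟩, rfl⟩, ?_⟩
  rw [Subgroup.smul_def, ← mul_smul]
  exact congrArg (· • r) (hR.equiv_fst_mul_equiv_snd a)

/-- The restriction of an action by automorphisms to a subgroup is an action by automorphisms. [folklore] -/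
theorem isActionByAut_subgroup (hact : IsActionByAut X A) (N : Subgroup A) : IsActionByAut X N :=
  fun n x y => hact (n : A) x y

/-- The restriction of a free action to a subgroup is free. [folklore] -/
theorem free_subgroup (hfree : ∀ (a : A) (w : W), a • w = w → a = 1) (N : Subgroup A) :
    ∀ (n : N) (w : W), n • w = w → n = 1 :=
  fun n w h => Subtype.ext (hfree (n : A) w (by rwa [Subgroup.smul_def] at h))

/-- Under a free action every stabiliser is trivial, in particular finite. [folklore] -/
theorem stabilizer_finite_of_free (hfree : ∀ (a : A) (w : W), a • w = w → a = 1) (w : W) :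
    (MulAction.stabilizer A w : Set A).Finite :=
  (Set.finite_singleton (1 : A)).subset fun a ha => hfree a w (MulAction.mem_stabilizer_iff.1 ha)

variable [X.LocallyFinite]

/-! ## §2 Φ2 for free cocompact VIRTUALLY nilpotent actions -/

/-- **UNCONDITIONAL IN THE TREE, NO GROWTH HYPOTHESIS, NO NAMED FACT — Φ2 for free cocompact VIRTUALLY NILPOTENT actions**: on every connected locally finite graph
carrying a FREE action with finitely many orbits by automorphisms of a group `A` with a finite-index NILPOTENT subgroup, `p_c < 1 ⟹ θ_x(p_c) = 0` at every vertex.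
(Restrict to the nilpotent subgroup, §1, and apply `conj4_of_free_nilpotent`.) [cite: BenjaminiSchramm1996, Conj. 4; §2] [cite: WolfGrowth1968, Thm. 3.2] -/
theorem conj4_of_free_virtuallyNilpotent (hc : X.Connected) (hact : IsActionByAut X A) (hfree : ∀ (a : A) (w : W), a • w = w → a = 1)
    (reps : Finset W) (hcover : ∀ w : W, ∃ a : A, ∃ r ∈ reps, a • r = w) (N : Subgroup A) [N.FiniteIndex] [Group.IsNilpotent N]
    (x : W) (hpc : criticalProb X x < 1) : theta X x (criticalProbIOf X x) = 0 := by
  obtain ⟨reps', hcover'⟩ := exists_reps_of_finiteIndex N reps hcover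
  exact conj4_of_free_nilpotent X hc N (isActionByAut_subgroup hact N) (free_subgroup hfree N) reps' hcover' x hpc

/-! ## §3 The dichotomy: `p_c < 1 ⟺` not virtually cyclic -/

/-- **`p_c < 1 ⟺ A` is not virtually cyclic**, for a free action with finitely many orbits by automorphisms of a virtually nilpotent `A` on a connected locally
finite graph — p4 gen 22's quasi-transitive dichotomy `VirtNilpotentAutQT.criticalProb_lt_one_iff_not_virtuallyCyclic` with its finite-stabiliser hypothesis
discharged by freeness. [cite: BenjaminiSchramm1996, §2 Conj. 1] [cite: LyonsPeres2016, §7.4 Cor. 7.19; §7.9] -/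
theorem criticalProb_lt_one_iff_of_free_virtuallyNilpotent (hc : X.Connected) (hact : IsActionByAut X A)
    (hfree : ∀ (a : A) (w : W), a • w = w → a = 1) (reps : Finset W) (hcover : ∀ w : W, ∃ a : A, ∃ r ∈ reps, a • r = w)
    (N : Subgroup A) [N.FiniteIndex] [Group.IsNilpotent N] (x : W) :
    criticalProb X x < 1 ↔ ¬ ∃ c : A, (Subgroup.zpowers c).FiniteIndex :=
  VirtNilpotentAutQT.criticalProb_lt_one_iff_not_virtuallyCyclic hact hc reps hcover (fun t _ => stabilizer_finite_of_free hfree t) N x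

/-- **CONJECTURES 1 AND 4 for free cocompact virtually nilpotent actions, algebraic hypotheses only**: `A` virtually nilpotent and NOT virtually cyclic, acting freely
with finitely many orbits by automorphisms on a connected locally finite graph ⟹ `p_c(x) < 1` and `θ_x(p_c) = 0` at every vertex `x`.  (In the virtually cyclic
case `p_c = 1`: `AutVirtCycQT.criticalProb_eq_one`.)  No growth hypothesis, no named fact, finite generation automatic.
[cite: BenjaminiSchramm1996, §2 Conj. 1, Conj. 4 (almost transitive graphs)] [cite: WolfGrowth1968, Thm. 3.2] [cite: LyonsPeres2016, §7.4 Cor. 7.19] -/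
theorem conj4_of_free_virtuallyNilpotent_of_not_virtuallyCyclic (hc : X.Connected) (hact : IsActionByAut X A)
    (hfree : ∀ (a : A) (w : W), a • w = w → a = 1) (reps : Finset W) (hcover : ∀ w : W, ∃ a : A, ∃ r ∈ reps, a • r = w)
    (N : Subgroup A) [N.FiniteIndex] [Group.IsNilpotent N] (hnvc : ¬ ∃ c : A, (Subgroup.zpowers c).FiniteIndex) (x : W) :
    criticalProb X x < 1 ∧ theta X x (criticalProbIOf X x) = 0 :=
  have hpc := (criticalProb_lt_one_iff_of_free_virtuallyNilpotent hc hact hfree reps hcover N x).2 hnvc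
  ⟨hpc, conj4_of_free_virtuallyNilpotent hc hact hfree reps hcover N x hpc⟩

end AutCyl

end Summit.CriticalPhenomena.PercolationContinuityZ3.Theorems.Transplant

end
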